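import Mathlib.FieldTheory.Finite.Basic

/-!
# SoloBlindDichotomyIdentity — the `𝔽_p`-product identity behind the multiplicative/additive dichotomy

Solo seat `solo-ResolutionOfSingularities-blind` (paper §11.2, Proposition 11.2(b); §13.1, Lemma 13.1 (DICH)).
At a zero `y` of the residual vector field `D̄` of a wild `ℤ/p`-automorphism along a fixed component of
multiplicity `m`, `p ∤ m`, the identity `(†₀)` says that the commuting operators `A + c·ā(y)` (`c ∈ 𝔽_p`,
`A` the linear part of `D̄` at `y`) have product zero.  The polynomial identity proved here,

  `∏_{c ∈ 𝔽_p} (X + c·α) = X ^ p - α ^ (p - 1) · X`   over any field of characteristic `p`,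

turns this into `A ^ p = ā(y) ^ (p-1) · A`: either `ā(y) ≠ 0` and `A` is semisimple with spectrum in
`𝔽_p · ā(y)` (MULTIPLICATIVE zero) or `ā(y) = 0` and `A` is nilpotent (ADDITIVE / NULL zero).
[folklore; the finite-field factorisation `X ^ q - X = ∏_{c ∈ K} (X - c)` is Mathlib's
`FiniteField.roots_X_pow_card_sub_X` repackaged.]
-/

open Polynomial

namespace Summit.ResolutionOfSingularities.ResolutionOfSingularities.Theorems
namespace SoloBlind

/-- `X ^ q - X = ∏_{c ∈ K} (X - c)` for a finite field `K` with `q` elements. [folklore] -/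
theorem finiteField_X_pow_card_sub_X_eq_prod (K : Type*) [Field K] [Fintype K] :
    (X ^ Fintype.card K - X : K[X]) = ∏ c : K, (X - C c) := by
  classical
  have hmonic : (X ^ Fintype.card K - X : K[X]).Monic :=
    monic_X_pow_sub (by rw [degree_X]; exact_mod_cast Fintype.one_lt_card)
  have h := prod_multiset_X_sub_C_of_monic_of_roots_card_eq hmonic (by
    rw [FiniteField.roots_X_pow_card_sub_X,
      FiniteField.X_pow_card_sub_X_natDegree_eq _ Fintype.one_lt_card]
    rfl)
  rw [FiniteField.roots_X_pow_card_sub_X] at h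
  rw [← h]
  rfl

/-- `X ^ p - X = ∏_{c ∈ ℤ/p} (X - c)` in `k[X]` for any field `k` of characteristic `p`. -/
theorem X_pow_sub_X_eq_prod_cast (k : Type*) [Field k] (p : ℕ) [Fact p.Prime] [CharP k p] :
    (X ^ p - X : k[X]) = ∏ c : ZMod p, (X - C (ZMod.cast c : k)) := by
  classical
  have h := congrArg (Polynomial.mapRingHom (ZMod.castHom (dvd_refl p) k))
    (finiteField_X_pow_card_sub_X_eq_prod (ZMod p))
  rw [map_sub, map_pow, map_prod] at h
  simpa only [Polynomial.coe_mapRingHom, Polynomial.map_X, Polynomial.map_sub, Polynomial.map_C,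
    ZMod.castHom_apply, ZMod.card] using h

/-- The homogeneous identity `∏_{c ∈ 𝔽_p} (X - c·α) = X ^ p - α ^ (p-1) · X` over a field of
characteristic `p` (for `α = 0` both sides are `X ^ p`). -/
theorem prod_X_sub_C_cast_mul (k : Type*) [Field k] (p : ℕ) [Fact p.Prime] [CharP k p] (α : k) :
    ∏ c : ZMod p, (X - C ((ZMod.cast c : k) * α)) = X ^ p - C (α ^ (p - 1)) * X := by
  classical
  have key0 := X_pow_sub_X_eq_prod_cast k p
  have hp : p.Prime := Fact.out
  obtain ⟨n, rfl⟩ : ∃ n, p = n + 1 := ⟨p - 1, by have := hp.two_le; omega⟩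
  have hn0 : n ≠ 0 := by have := hp.two_le; omega
  simp only [Nat.add_sub_cancel]
  by_cases hα : α = 0
  · subst hα
    simp [Finset.prod_const, Finset.card_univ, ZMod.card, zero_pow hn0]
  · have e1 : (C α : k[X]) * C α⁻¹ = 1 := by rw [← C_mul, mul_inv_cancel₀ hα, C_1]
    have key := congrArg (aeval (C α⁻¹ * X : k[X])) key0
    simp only [map_sub, map_pow, map_prod, aeval_X, aeval_C, Polynomial.algebraMap_eq] at key
    -- key : (C α⁻¹ * X) ^ (n+1) - C α⁻¹ * X = ∏ c, (C α⁻¹ * X - C (ZMod.cast c : k))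
    have hL : (C α : k[X]) ^ (n + 1) * ((C α⁻¹ * X) ^ (n + 1) - C α⁻¹ * X)
        = X ^ (n + 1) - C (α ^ n) * X := by
      calc (C α : k[X]) ^ (n + 1) * ((C α⁻¹ * X) ^ (n + 1) - C α⁻¹ * X)
          = (C α * C α⁻¹) ^ (n + 1) * X ^ (n + 1) - (C α) ^ n * (C α * C α⁻¹) * X := by ring
        _ = X ^ (n + 1) - C (α ^ n) * X := by rw [e1, C_pow]; ring
    have hR : (C α : k[X]) ^ (n + 1) * ∏ c : ZMod (n + 1), (C α⁻¹ * X - C (ZMod.cast c : k))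
        = ∏ c : ZMod (n + 1), (X - C ((ZMod.cast c : k) * α)) := by
      have hc : (C α : k[X]) ^ (n + 1) = ∏ _c : ZMod (n + 1), C α := by
        simp [Finset.prod_const, Finset.card_univ, ZMod.card]
      rw [hc, ← Finset.prod_mul_distrib]
      refine Finset.prod_congr rfl fun c _ => ?_
      calc C α * (C α⁻¹ * X - C (ZMod.cast c : k)) = (C α * C α⁻¹) * X - C ((ZMod.cast c : k) * α) := by
            rw [C_mul]; ring
        _ = X - C ((ZMod.cast c : k) * α) := by rw [e1, one_mul]
    rw [← hR, ← key, hL]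

/-- The same identity with `+` signs (reindex by `c ↦ -c`):
`∏_{c ∈ 𝔽_p} (X + c·α) = X ^ p - α ^ (p-1) · X`. This is the form used in Proposition 11.2(b). -/
theorem prod_X_add_C_cast_mul (k : Type*) [Field k] (p : ℕ) [Fact p.Prime] [CharP k p] (α : k) :
    ∏ c : ZMod p, (X + C ((ZMod.cast c : k) * α)) = X ^ p - C (α ^ (p - 1)) * X := by
  classical
  rw [← prod_X_sub_C_cast_mul k p α]
  refine Fintype.prod_equiv (Equiv.neg (ZMod p)) _ _ fun c => ?_
  rw [Equiv.neg_apply, ZMod.cast_neg (dvd_refl p), neg_mul, C_neg, sub_neg_eq_add]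

/-- Evaluated form in a commutative `k`-algebra `B` (e.g. `B = k[A]` for a single endomorphism `A`):
`∏_{c ∈ 𝔽_p} (a + c·α) = a ^ p - α ^ (p-1) · a`. -/
theorem prod_add_algebraMap_mul (k : Type*) [Field k] (p : ℕ) [Fact p.Prime] [CharP k p]
    (B : Type*) [CommRing B] [Algebra k B] (a : B) (α : k) :
    ∏ c : ZMod p, (a + algebraMap k B ((ZMod.cast c : k) * α))
      = a ^ p - algebraMap k B (α ^ (p - 1)) * a := by
  classical
  have h := congrArg (aeval a) (prod_X_add_C_cast_mul k p α)
  simpa only [map_prod, map_add, map_sub, map_mul, map_pow, aeval_X, aeval_C] using h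

/-- The dichotomy step of Proposition 11.2(b): if the commuting factors `a + c·α`, `c ∈ 𝔽_p`, have
product zero, then `a ^ p = α ^ (p-1) · a` — so `a` is annihilated by `X ^ p - α^(p-1) X`, which is
separable with roots `𝔽_p · α` when `α ≠ 0` and is `X ^ p` when `α = 0`. -/
theorem pow_eq_of_prod_add_eq_zero (k : Type*) [Field k] (p : ℕ) [Fact p.Prime] [CharP k p]
    (B : Type*) [CommRing B] [Algebra k B] (a : B) (α : k)
    (h : ∏ c : ZMod p, (a + algebraMap k B ((ZMod.cast c : k) * α)) = 0) :
    a ^ p = algebraMap k B (α ^ (p - 1)) * a := by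
  rw [prod_add_algebraMap_mul k p B a α] at h
  exact sub_eq_zero.mp h

end SoloBlind
end Summit.ResolutionOfSingularities.ResolutionOfSingularities.Theorems
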